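import Summits.AtomisticToContinuum.BoseEinsteinCondensation.Theorems.BECThomsonPrincipleFibreFubini
import Summits.FinalStateConjecture.FinalStateConjecture.Theorems.PhotonSphereChannelsParametricPrimitive
import HarnessLib

/-!
# Route `BECThomsonPrinciple`, crux `FibreConductance` (stmt-AtomisticToContinuum-9480),
# line `tagged-path-harnack-cage-moments` — stub `stub_flatteningOfMoments`, part 1:
# calculus along the coordinate lines of the tagged particle

Infrastructure for the ITERATED-PRIMITIVE flow of `stub_flatteningOfMoments`
(`FlatteningOfMoments : ConditionalDensityMoments → DensityFlatteningCubic`). For a function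
`f` on configuration space `(ℝ³)^{m+1}` and a fibre axis `l : Fin 3` of the tagged particle `0`:

* `fibreDir l = e₀ ⊗ e_l`, the coordinate line `linePt l X t = X + (t − x_{0,l}) e₀ ⊗ e_l`;
* the LINE AVERAGE `lineAvg L l f X = L⁻¹ ∫₀ᴸ f (linePt l X t) dt` (constant along the line,
  periodic when `f` is, `C¹` when `f` is: `contDiff_parametric_intervalIntegral_nat`);
* the LINE PRIMITIVE `linePrim l f X = ∫₀^{x_{0,l}} f (linePt l X t) dt` (`C¹` when `f` is:
  `contDiff_parametric_primitive_nat`; derivative `f` along `e₀ ⊗ e_l` by the fundamental theorem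
  of calculus; periodic along its own axis when the line integral of `f` over a period vanishes);
* the FLUCTUATION `c (f − ⟨f⟩_l)` has zero line integral and its primitive is bounded by
  `2 c L ⟨f⟩_l` on the closed cell for `f ≥ 0` (`abs_linePrim_fluct_le`).

All [folklore] (one-variable calculus; Folland, *Real Analysis*, §2.5–2.6).
-/

noncomputable section

namespace Summit.AtomisticToContinuum.BoseEinsteinCondensation.Cruxes.FibreConductance.TaggedPathHarnack

open MeasureTheory intervalIntegral
open scoped ENNReal
open Literature.MathematicalPhysics.QuantumManyBody.BoseGas
open Summit.AtomisticToContinuum.BoseEinsteinCondensation.Cruxes.FibreConductance.ParsevalShellBootstrap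
open Summit.FinalStateConjecture.FinalStateConjecture.Theorems.WaveEnergy
  (contDiff_parametric_intervalIntegral_nat contDiff_parametric_primitive_nat)

variable {m : ℕ} {L : ℝ}

/-! ### Coordinate lines of the tagged particle -/

/-- The unit vector `e₀ ⊗ e_l` of the fibre coordinate `x_{0,l}` in configuration space. [folklore] -/
def fibreDir (l : Fin 3) : Config (m + 1) := Pi.single 0 (EuclideanSpace.single l 1)

/-- `(X + c e₀⊗e_l)_{0,l} = x_{0,l} + c`. [folklore] -/
@[simp] theorem add_smul_fibreDir_apply_self (X : Config (m + 1)) (c : ℝ) (l : Fin 3) :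
    (X + c • (fibreDir l : Config (m + 1))) 0 l = X 0 l + c := by
  simp [fibreDir]

/-- The period vector `L e₀ ⊗ e_l` is `L • fibreDir l`. [folklore] -/
theorem single_zero_single_eq_smul_fibreDir (l : Fin 3) (L : ℝ) :
    (Pi.single 0 (EuclideanSpace.single l L) : Config (m + 1)) = L • fibreDir l := by
  rw [fibreDir, ← Pi.single_smul]
  congr 1
  ext j
  by_cases h : j = l
  · subst h; simp
  · simp [h]

/-- A period vector `L eᵢ ⊗ e_k` other than `L e₀ ⊗ e_l` has vanishing `(0,l)` coordinate.
[folklore] -/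
theorem single_single_apply_zero_eq_zero {i : Fin (m + 1)} {k l : Fin 3} (h : ¬(i = 0 ∧ k = l))
    (L : ℝ) : (Pi.single i (EuclideanSpace.single k L) : Config (m + 1)) 0 l = 0 := by
  rcases eq_or_ne i 0 with rfl | hi
  · have hk : l ≠ k := fun hk => h ⟨rfl, hk.symm⟩
    simp [hk]
  · simp [hi.symm]

/-- The point of the coordinate line through `X` along `x_{0,l}` whose `(0,l)` coordinate is `t`
(all other coordinates those of `X`). [folklore] -/
def linePt (l : Fin 3) (X : Config (m + 1)) (t : ℝ) : Config (m + 1) :=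
  X + (t - X 0 l) • fibreDir l

/-- The line does not depend on where on it we start. [folklore] -/
@[simp] theorem linePt_add_smul (l : Fin 3) (X : Config (m + 1)) (c t : ℝ) :
    linePt l (X + c • fibreDir l) t = linePt l X t := by
  rw [linePt, linePt, add_smul_fibreDir_apply_self, add_assoc, ← add_smul]
  congr 2
  ring

/-- `linePt l X (x_{0,l}) = X`. [folklore] -/
@[simp] theorem linePt_self (l : Fin 3) (X : Config (m + 1)) : linePt l X (X 0 l) = X := by
  simp [linePt]

/-- The `(0,l)` coordinate of `linePt l X t` is `t`. [folklore] -/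
@[simp] theorem linePt_apply_self (l : Fin 3) (X : Config (m + 1)) (t : ℝ) :
    (linePt l X t) 0 l = t := by
  rw [linePt, add_smul_fibreDir_apply_self]
  ring

/-- Points of the line have the same line. [folklore] -/
@[simp] theorem linePt_linePt (l : Fin 3) (X : Config (m + 1)) (s t : ℝ) :
    linePt l (linePt l X s) t = linePt l X t :=
  linePt_add_smul l X _ t

/-- `linePt l X (t + c) = linePt l X t + c e₀⊗e_l`. [folklore] -/
theorem linePt_add_right (l : Fin 3) (X : Config (m + 1)) (t c : ℝ) :
    linePt l X (t + c) = linePt l X t + c • fibreDir l := by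
  rw [linePt, linePt, add_assoc, ← add_smul]
  congr 2
  ring

/-- Translations with vanishing `(0,l)` coordinate commute with the line map. [folklore] -/
theorem linePt_add_of_apply_eq_zero (l : Fin 3) (X : Config (m + 1)) {v : Config (m + 1)}
    (hv : v 0 l = 0) (t : ℝ) : linePt l (X + v) t = linePt l X t + v := by
  simp only [linePt, Pi.add_apply, PiLp.add_apply, hv, add_zero]
  abel

/-- The line map is smooth (affine) jointly in `(t, X)`. [folklore] -/
theorem contDiff_coord (l : Fin 3) {n : WithTop ℕ∞} : ContDiff ℝ n fun X : Config (m + 1) => X 0 l :=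
  (PiLp.proj 2 (fun _ : Fin 3 => ℝ) l).contDiff.comp (contDiff_apply ℝ Space 0)

/-- The line map is smooth (affine) jointly in `(t, X)`. [folklore] -/
theorem contDiff_linePt (l : Fin 3) {n : WithTop ℕ∞} :
    ContDiff ℝ n fun q : ℝ × Config (m + 1) => linePt l q.2 q.1 := by
  unfold linePt
  exact contDiff_snd.add ((contDiff_fst.sub ((contDiff_coord l).comp contDiff_snd)).smul
    contDiff_const)

/-- The line map is continuous in `t`. [folklore] -/
theorem continuous_linePt (l : Fin 3) (X : Config (m + 1)) : Continuous fun t : ℝ => linePt l X t :=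
  (contDiff_linePt (m := m) l (n := 0)).continuous.comp (Continuous.prodMk_left X)

/-! ### Line averages -/

/-- The LINE AVERAGE `⟨f⟩_l (X) = L⁻¹ ∫₀ᴸ f(X with x_{0,l} = t) dt`. [folklore] -/
def lineAvg (L : ℝ) (l : Fin 3) (f : Config (m + 1) → ℝ) (X : Config (m + 1)) : ℝ :=
  L⁻¹ * ∫ t in (0 : ℝ)..L, f (linePt l X t)

/-- The line average is constant along its line. [folklore] -/
@[simp] theorem lineAvg_add_smul (L : ℝ) (l : Fin 3) (f : Config (m + 1) → ℝ) (X : Config (m + 1))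
    (c : ℝ) : lineAvg L l f (X + c • fibreDir l) = lineAvg L l f X := by
  simp only [lineAvg, linePt_add_smul]

/-- The line average is constant along its line. [folklore] -/
@[simp] theorem lineAvg_linePt (L : ℝ) (l : Fin 3) (f : Config (m + 1) → ℝ) (X : Config (m + 1))
    (s : ℝ) : lineAvg L l f (linePt l X s) = lineAvg L l f X :=
  lineAvg_add_smul L l f X _

/-- Line averages of `v`-periodic functions are `v`-periodic (`v` transverse to the line).
[folklore] -/
theorem lineAvg_add_of_apply_eq_zero (L : ℝ) (l : Fin 3) {f : Config (m + 1) → ℝ}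
    {v : Config (m + 1)} (hv : v 0 l = 0) (hf : ∀ Y, f (Y + v) = f Y) (X : Config (m + 1)) :
    lineAvg L l f (X + v) = lineAvg L l f X := by
  simp only [lineAvg, linePt_add_of_apply_eq_zero l X hv, hf]

/-- Line averages of torus-periodic functions are torus-periodic. [folklore] -/
theorem lineAvg_periodic (L : ℝ) (l : Fin 3) {f : Config (m + 1) → ℝ}
    (hf : ∀ (X : Config (m + 1)) (i : Fin (m + 1)) (k : Fin 3),
      f (X + Pi.single i (EuclideanSpace.single k L)) = f X)
    (X : Config (m + 1)) (i : Fin (m + 1)) (k : Fin 3) :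
    lineAvg L l f (X + Pi.single i (EuclideanSpace.single k L)) = lineAvg L l f X := by
  by_cases h : i = 0 ∧ k = l
  · obtain ⟨rfl, rfl⟩ := h
    rw [single_zero_single_eq_smul_fibreDir, lineAvg_add_smul]
  · exact lineAvg_add_of_apply_eq_zero L l (single_single_apply_zero_eq_zero h L)
      (fun Y => hf Y i k) X

/-- Line averages of nonnegative functions are nonnegative (`0 ≤ L`). [folklore] -/
theorem lineAvg_nonneg (hL : 0 ≤ L) (l : Fin 3) {f : Config (m + 1) → ℝ} (hf : ∀ Y, 0 ≤ f Y)
    (X : Config (m + 1)) : 0 ≤ lineAvg L l f X :=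
  mul_nonneg (inv_nonneg.2 hL) (intervalIntegral.integral_nonneg hL fun _ _ => hf _)

/-- Line averages of `C¹` functions are `C¹` (differentiation under the integral). [folklore] -/
theorem contDiff_lineAvg (L : ℝ) (l : Fin 3) {f : Config (m + 1) → ℝ} (hf : ContDiff ℝ 1 f) :
    ContDiff ℝ 1 (lineAvg L l f) := by
  have hH : ContDiff ℝ (1 : ℕ) fun q : ℝ × Config (m + 1) => f (linePt l q.2 q.1) := by
    exact_mod_cast hf.comp (contDiff_linePt l)
  have h := contDiff_parametric_intervalIntegral_nat (P := Config (m + 1)) 0 L 1 hH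
  exact contDiff_const.mul (by exact_mod_cast h)

/-- Line averages of `C¹` functions are continuous. [folklore] -/
theorem continuous_lineAvg (L : ℝ) (l : Fin 3) {f : Config (m + 1) → ℝ} (hf : ContDiff ℝ 1 f) :
    Continuous (lineAvg L l f) :=
  (contDiff_lineAvg L l hf).continuous

/-! ### Line primitives -/

/-- The LINE PRIMITIVE `∫₀^{x_{0,l}} f(X with x_{0,l} = t) dt`. [folklore] -/
def linePrim (l : Fin 3) (f : Config (m + 1) → ℝ) (X : Config (m + 1)) : ℝ :=
  ∫ t in (0 : ℝ)..X 0 l, f (linePt l X t)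

/-- Moving along the line only moves the upper limit. [folklore] -/
theorem linePrim_add_smul (l : Fin 3) (f : Config (m + 1) → ℝ) (X : Config (m + 1)) (c : ℝ) :
    linePrim l f (X + c • fibreDir l) = ∫ t in (0 : ℝ)..(X 0 l + c), f (linePt l X t) := by
  simp only [linePrim, linePt_add_smul, add_smul_fibreDir_apply_self]

/-- Line primitives of `v`-periodic functions are `v`-periodic (`v` transverse to the line).
[folklore] -/
theorem linePrim_add_of_apply_eq_zero (l : Fin 3) {f : Config (m + 1) → ℝ} {v : Config (m + 1)}
    (hv : v 0 l = 0) (hf : ∀ Y, f (Y + v) = f Y) (X : Config (m + 1)) :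
    linePrim l f (X + v) = linePrim l f X := by
  rw [linePrim, linePrim, show (X + v) 0 l = X 0 l by simp [hv]]
  simp only [linePt_add_of_apply_eq_zero l X hv, hf]

/-- A line primitive is periodic ALONG ITS OWN LINE when the integrand is periodic along the line
and its line integral over one period vanishes. [folklore] -/
theorem linePrim_add_period (l : Fin 3) {f : Config (m + 1) → ℝ} (hfc : Continuous f)
    (hper : ∀ Y, f (Y + L • fibreDir l) = f Y) (X : Config (m + 1))
    (havg : ∫ t in (0 : ℝ)..L, f (linePt l X t) = 0) :
    linePrim l f (X + L • fibreDir l) = linePrim l f X := by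
  rw [linePrim_add_smul, linePrim]
  have hφ : Function.Periodic (fun t => f (linePt l X t)) L := fun t => by
    simp only
    rw [linePt_add_right, hper]
  have hi : ∀ a b : ℝ, IntervalIntegrable (fun t => f (linePt l X t)) volume a b := fun a b =>
    (hfc.comp (continuous_linePt l X)).intervalIntegrable a b
  rw [← integral_add_adjacent_intervals (hi 0 (X 0 l)) (hi (X 0 l) (X 0 l + L)),
    hφ.intervalIntegral_add_eq (X 0 l) 0, zero_add, havg, add_zero]

/-- Line primitives of torus-periodic continuous functions with vanishing line integrals are
torus-periodic. [folklore] -/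
theorem linePrim_periodic (l : Fin 3) {f : Config (m + 1) → ℝ} (hfc : Continuous f)
    (hf : ∀ (X : Config (m + 1)) (i : Fin (m + 1)) (k : Fin 3),
      f (X + Pi.single i (EuclideanSpace.single k L)) = f X)
    (havg : ∀ X : Config (m + 1), ∫ t in (0 : ℝ)..L, f (linePt l X t) = 0)
    (X : Config (m + 1)) (i : Fin (m + 1)) (k : Fin 3) :
    linePrim l f (X + Pi.single i (EuclideanSpace.single k L)) = linePrim l f X := by
  by_cases h : i = 0 ∧ k = l
  · obtain ⟨rfl, rfl⟩ := h
    rw [single_zero_single_eq_smul_fibreDir]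
    refine linePrim_add_period k hfc (fun Y => ?_) X (havg X)
    rw [← single_zero_single_eq_smul_fibreDir]
    exact hf Y 0 k
  · exact linePrim_add_of_apply_eq_zero l (single_single_apply_zero_eq_zero h L)
      (fun Y => hf Y i k) X

/-- Line primitives of `C¹` functions are `C¹` (`θ`-trick for the variable upper limit and
differentiation under the integral). [folklore] -/
theorem contDiff_linePrim (l : Fin 3) {f : Config (m + 1) → ℝ} (hf : ContDiff ℝ 1 f) :
    ContDiff ℝ 1 (linePrim l f) := by
  have hH : ContDiff ℝ (1 : ℕ) fun q : ℝ × Config (m + 1) => f (linePt l q.2 q.1) := by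
    exact_mod_cast hf.comp (contDiff_linePt l)
  have h := contDiff_parametric_primitive_nat (Q := Config (m + 1)) 1 hH
  have h1 : ContDiff ℝ 1 fun q : ℝ × Config (m + 1) => ∫ s in (0 : ℝ)..q.1, f (linePt l q.2 s) := by
    exact_mod_cast h
  have h2 : ContDiff ℝ 1 fun X : Config (m + 1) => ((X 0 l, X) : ℝ × Config (m + 1)) :=
    (contDiff_coord l).prodMk contDiff_id
  exact h1.comp h2

/-- Line primitives of `C¹` functions are continuous. [folklore] -/
theorem continuous_linePrim (l : Fin 3) {f : Config (m + 1) → ℝ} (hf : ContDiff ℝ 1 f) :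
    Continuous (linePrim l f) :=
  (contDiff_linePrim l hf).continuous

/-- **Fundamental theorem of calculus along the line**: the derivative of the line primitive along
`e₀ ⊗ e_l` is the integrand. [folklore] -/
theorem hasDerivAt_linePrim (l : Fin 3) {f : Config (m + 1) → ℝ} (hfc : Continuous f)
    (X : Config (m + 1)) :
    HasDerivAt (fun s : ℝ => linePrim l f (X + s • fibreDir l)) (f X) 0 := by
  simp only [linePrim_add_smul]
  have hφ : Continuous fun t => f (linePt l X t) := hfc.comp (continuous_linePt l X)
  have h1 : HasDerivAt (fun u => ∫ t in (0 : ℝ)..u, f (linePt l X t)) (f (linePt l X (X 0 l)))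
      (X 0 l) :=
    intervalIntegral.integral_hasDerivAt_right (hφ.intervalIntegrable _ _)
      hφ.aestronglyMeasurable.stronglyMeasurableAtFilter hφ.continuousAt
  rw [linePt_self] at h1
  have h2 : HasDerivAt (fun u => ∫ t in (0 : ℝ)..u, f (linePt l X t)) (f X) (X 0 l + 0) := by
    rwa [add_zero]
  exact h2.comp_const_add (X 0 l) 0

/-- The Fréchet derivative of the line primitive of a `C¹` function in the direction `e₀ ⊗ e_l` is
the integrand. [folklore] -/
theorem fderiv_linePrim_fibreDir (l : Fin 3) {f : Config (m + 1) → ℝ} (hf : ContDiff ℝ 1 f)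
    (X : Config (m + 1)) : fderiv ℝ (linePrim l f) X (fibreDir l) = f X := by
  have hd : DifferentiableAt ℝ (linePrim l f) X :=
    (contDiff_linePrim l hf).differentiable one_ne_zero X
  have h1 : HasLineDerivAt ℝ (linePrim l f) (fderiv ℝ (linePrim l f) X (fibreDir l)) X (fibreDir l) :=
    hd.hasFDerivAt.hasLineDerivAt _
  have h2 : HasLineDerivAt ℝ (linePrim l f) (f X) X (fibreDir l) := hasDerivAt_linePrim l hf.continuous X
  exact h1.unique h2

/-! ### Fluctuations about the line average -/

/-- The FLUCTUATION `c (f − ⟨f⟩_l)` of `f` about its line average, scaled by `c`. [folklore] -/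
def fluct (c L : ℝ) (l : Fin 3) (f : Config (m + 1) → ℝ) (X : Config (m + 1)) : ℝ :=
  c * (f X - lineAvg L l f X)

/-- The fluctuation has vanishing line integral over a period (`L ≠ 0`). [folklore] -/
theorem intervalIntegral_fluct (hL : L ≠ 0) (c : ℝ) (l : Fin 3) {f : Config (m + 1) → ℝ}
    (hfc : Continuous f) (X : Config (m + 1)) :
    ∫ t in (0 : ℝ)..L, fluct c L l f (linePt l X t) = 0 := by
  simp only [fluct, lineAvg_linePt]
  have hφ : IntervalIntegrable (fun t => f (linePt l X t)) volume 0 L :=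
    (hfc.comp (continuous_linePt l X)).intervalIntegrable _ _
  rw [intervalIntegral.integral_const_mul, intervalIntegral.integral_sub hφ intervalIntegrable_const,
    intervalIntegral.integral_const, smul_eq_mul, lineAvg, sub_zero, ← mul_assoc,
    mul_inv_cancel₀ hL, one_mul, sub_self, mul_zero]

/-- The fluctuation is torus-periodic when `f` is. [folklore] -/
theorem fluct_periodic (c L : ℝ) (l : Fin 3) {f : Config (m + 1) → ℝ}
    (hf : ∀ (X : Config (m + 1)) (i : Fin (m + 1)) (k : Fin 3),
      f (X + Pi.single i (EuclideanSpace.single k L)) = f X)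
    (X : Config (m + 1)) (i : Fin (m + 1)) (k : Fin 3) :
    fluct c L l f (X + Pi.single i (EuclideanSpace.single k L)) = fluct c L l f X := by
  simp only [fluct, hf, lineAvg_periodic L l hf]

/-- The fluctuation of a `C¹` function is `C¹`. [folklore] -/
theorem contDiff_fluct (c L : ℝ) (l : Fin 3) {f : Config (m + 1) → ℝ} (hf : ContDiff ℝ 1 f) :
    ContDiff ℝ 1 (fluct c L l f) :=
  contDiff_const.mul (hf.sub (contDiff_lineAvg L l hf))

/-- **Primitive bound**: on the closed slab `0 ≤ x_{0,l} ≤ L`, for `f ≥ 0` and `c ≥ 0`,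
`|∫₀^{x_{0,l}} c (f − ⟨f⟩_l)| ≤ ∫₀ᴸ c (f + ⟨f⟩_l) = 2 c L ⟨f⟩_l`. [folklore] -/
theorem abs_linePrim_fluct_le (hL : 0 < L) {c : ℝ} (hc : 0 ≤ c) (l : Fin 3)
    {f : Config (m + 1) → ℝ} (hfc : Continuous f) (hf0 : ∀ Y, 0 ≤ f Y) {X : Config (m + 1)}
    (h0 : 0 ≤ X 0 l) (h1 : X 0 l ≤ L) :
    |linePrim l (fluct c L l f) X| ≤ 2 * c * L * lineAvg L l f X := by
  set A : ℝ := lineAvg L l f X with hA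
  have hφc : Continuous fun t => f (linePt l X t) := hfc.comp (continuous_linePt l X)
  have hA0 : 0 ≤ A := lineAvg_nonneg hL.le l hf0 X
  have hint : ∫ t in (0 : ℝ)..L, f (linePt l X t) = L * A := by
    rw [hA, lineAvg, ← mul_assoc, mul_inv_cancel₀ hL.ne', one_mul]
  have hgc : Continuous fun t => c * (f (linePt l X t) - A) :=
    continuous_const.mul (hφc.sub continuous_const)
  have hi : ∀ a b : ℝ, IntervalIntegrable (fun t => |c * (f (linePt l X t) - A)|) volume a b :=
    fun a b => hgc.abs.intervalIntegrable a b
  unfold linePrim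
  simp only [fluct, lineAvg_linePt, ← hA]
  calc |∫ t in (0 : ℝ)..X 0 l, c * (f (linePt l X t) - A)|
      ≤ ∫ t in (0 : ℝ)..X 0 l, |c * (f (linePt l X t) - A)| :=
        intervalIntegral.abs_integral_le_integral_abs h0
    _ ≤ ∫ t in (0 : ℝ)..L, |c * (f (linePt l X t) - A)| :=
        intervalIntegral.integral_mono_interval le_rfl h0 h1
          (Filter.Eventually.of_forall fun _ => abs_nonneg _) (hi 0 L)
    _ ≤ ∫ t in (0 : ℝ)..L, c * (f (linePt l X t) + A) := by
        refine intervalIntegral.integral_mono_on hL.le (hi 0 L)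
          ((continuous_const.mul (hφc.add continuous_const)).intervalIntegrable _ _) fun t _ => ?_
        rw [abs_mul, abs_of_nonneg hc]
        refine mul_le_mul_of_nonneg_left ?_ hc
        have := hf0 (linePt l X t)
        exact (abs_sub _ _).trans (by rw [abs_of_nonneg this, abs_of_nonneg hA0])
    _ = 2 * c * L * A := by
        rw [intervalIntegral.integral_const_mul,
          intervalIntegral.integral_add (hφc.intervalIntegrable _ _) intervalIntegrable_const,
          intervalIntegral.integral_const, hint, smul_eq_mul, sub_zero]
        ring

end Summit.AtomisticToContinuum.BoseEinsteinCondensation.Cruxes.FibreConductance.TaggedPathHarnack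

end
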